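import Mathlib
import Literature.Probability.RandomPlanarGeometry.SLETwoPointItoProofs
import Literature.Probability.RandomPlanarGeometry.SLEExistenceNeEightHolds
import Literature.Probability.RandomPlanarGeometry.CardyFunctionIncBeta
import Literature.Probability.RandomPlanarGeometry.ConformalRectangleProofs
import Literature.Probability.RandomPlanarGeometry.ConformalRestrictionProofs
import Literature.Probability.RandomPlanarGeometry.LatticeSimilarityCovariance
import HarnessLib

/-!
# SLE₆-preserving homeomorphisms preserve the conformal modulus

Topic `Literature/Probability/RandomPlanarGeometry` (input of the rigidity step "isotropy kills
Beltrami" of crux stmt-CriticalPhenomena-0698, `Summits/CriticalPhenomena/CardyFormulaZ2`).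

If a homeomorphism `T` of the plane pushes the chordal SLE₆ law of every Dobrushin domain `D` to
the chordal SLE₆ law of its image `T D`, then `T` preserves Cardy's cross-ratio (the conformal
modulus) of every conformal rectangle (`crossRatio_eq_of_sle`): by Cardy's formula for SLE₆
(tree: `sle_six_measureReal_hitsBefore_holds`; Lawler–Schramm–Werner 2001 §3, Smirnov 2001,
Werner 2007 §3) the crossing probability of `(Ω; a, b, c, d)` is `F(η)` with `F` Cardy's function,
strictly increasing on `[0, 1]` (`strictMonoOn_cardyFunction_holds`), and the crossing event is
transported by `T` (`preimage_curveClassMap_hitsBefore`).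

On the way, `crossRatio_eq_of_hasBoundaryValue`: Cardy's cross-ratio of a conformal rectangle
computed from ANY conformal chart `φ : ℍ → R` and real points `x i` at which `φ` has boundary
value `R.pt i` is intrinsic — the tree's `ConformalRectangle.crossRatio_eq_of_isUniformizing_holds`
without the monotonicity clause of `IsUniformizing`, which its proof never uses (proof repeated).

## References

* G. Lawler, O. Schramm, W. Werner, *Values of Brownian intersection exponents I*, Acta Math. 187
  (2001), §3 (Cardy's formula for SLE₆).
* W. Werner, *Lectures on two-dimensional critical percolation*, IAS/Park City (2007), §3.
-/

noncomputable section

open MeasureTheory Set Filter Topology Complex Metric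
open UpperHalfPlane (upperHalfPlaneSet)
open scoped ENNReal

namespace Literature.Probability.RandomPlanarGeometry

/-! ### Transport of the crossing event -/

/-- Pushing a curve forward along `T` and back along `T⁻¹` gives the curve back (copy of
`curve_map_map_symm` of `…HomeoTransport`, renamed, to keep this file's imports light). [folklore] -/
theorem curve_map_then_symm (T : ℂ ≃ₜ ℂ) (γ : Curve ℂ) :
    (γ.map (T : C(ℂ, ℂ))).map (T.symm : C(ℂ, ℂ)) = γ :=
  Curve.ext (ContinuousMap.ext fun t ↦ by simp)

/-- **Transport of the crossing event.** For a homeomorphism `T` of the plane and any two sets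
`A, B`, a curve class hits `A` before `B` iff its image under `T` hits `T A` before `T B`:
`(CurveClass.map T)⁻¹' hitsBefore (T '' A) (T '' B) = hitsBefore A B`. [folklore] -/
theorem preimage_curveClassMap_hitsBefore (T : ℂ ≃ₜ ℂ) (A B : Set ℂ) :
    CurveClass.map (T : C(ℂ, ℂ)) ⁻¹' CurveClass.hitsBefore (T '' A) (T '' B) =
      CurveClass.hitsBefore A B := by
  ext c
  obtain ⟨γ₀, rfl⟩ := CurveClass.surjective_mk c
  constructor
  · rintro ⟨γ', ⟨t, htA, htB⟩, hγ'⟩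
    -- `c` is the class of `T⁻¹ ∘ γ'`
    have hc : CurveClass.mk γ₀ = CurveClass.mk (γ'.map (T.symm : C(ℂ, ℂ))) := by
      have h1 := congrArg (CurveClass.map (T.symm : C(ℂ, ℂ))) hγ'
      rw [CurveClass.map_mk] at h1
      rw [h1]
      have h2 : CurveClass.map (T : C(ℂ, ℂ)) (CurveClass.mk γ₀) =
          CurveClass.mk (γ₀.map (T : C(ℂ, ℂ))) := CurveClass.map_mk _ _
      rw [h2, CurveClass.map_mk, curve_map_then_symm]
    rw [hc]
    refine CurveClass.mk_mem_hitsBefore (t := t) ?_ fun s hs hsB ↦ ?_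
    · obtain ⟨a, ha, hta⟩ := htA
      simpa [← hta] using ha
    · refine htB s hs ⟨T.symm (γ' s), by simpa using hsB, ?_⟩
      simp
  · rintro ⟨γ, ⟨t, htA, htB⟩, hγ⟩
    rw [← hγ, Set.mem_preimage, CurveClass.map_mk]
    refine CurveClass.mk_mem_hitsBefore (t := t) ⟨γ t, htA, rfl⟩ fun s hs ⟨b, hb, hbs⟩ ↦ ?_
    have : b = γ s := T.injective (by simpa using hbs)
    exact htB s hs (this ▸ hb)

/-! ### The cross-ratio of boundary-value data is intrinsic -/

/-- **Cardy's cross-ratio from any chart.** If `φ, φ' : ℍ → R` are conformal equivalences onto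
the carrier of a conformal rectangle with boundary value `R.pt i` at the real points `x i`,
resp. `x' i` (`i < 4`), then `crossRatio x = crossRatio x'`. This is
`ConformalRectangle.crossRatio_eq_of_isUniformizing_holds` without the (unused) monotonicity
clause of `MarkedDomain.IsUniformizing`; the proof is the tree's, verbatim: `φ⁻¹ ∘ φ'` is a real
Möbius self-map of `ℍ` carrying `x' i` to `x i` (Carathéodory,
`JordanDomain.exists_continuousOn_extension_holds`), and Möbius maps preserve the cross-ratio. [cite: PommerenkeBBCM1992, Thm. 2.6 and Cor. 2.7] -/
theorem crossRatio_eq_of_hasBoundaryValue {R : ConformalRectangle}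
    {φ φ' : ConformalEquiv upperHalfPlaneSet R.carrier} {x x' : Fin 4 → ℝ}
    (hφ : ∀ i, φ.HasBoundaryValue (x i) (R.pt i)) (hφ' : ∀ i, φ'.HasBoundaryValue (x' i) (R.pt i)) :
    crossRatio x = crossRatio x' := by
  obtain ⟨Ψ, hΨc, hΨeq, hbij, -⟩ :=
    JordanDomain.exists_continuousOn_extension_holds R.toJordanDomain (cayley.symm.trans φ)
  set M : ConformalEquiv upperHalfPlaneSet upperHalfPlaneSet := φ'.trans φ.symm with hM
  have hlim : ∀ i, Tendsto M (𝓝[upperHalfPlaneSet] (x' i)) (𝓝 (x i)) := fun i ↦ by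
    have h1 : Tendsto φ' (𝓝[upperHalfPlaneSet] (x' i)) (𝓝[R.carrier] (R.pt i)) :=
      tendsto_nhdsWithin_iff.2 ⟨hφ' i, eventually_nhdsWithin_of_forall fun z hz ↦ φ'.mapsTo hz⟩
    exact (JordanDomain.tendsto_symm_nhds φ hΨc hΨeq hbij.injOn (hφ i)).comp h1
  obtain ⟨q, p, hq, u, hu, hMn⟩ := M.exists_eqOn_normalForm
  have hb := fun i ↦ ConformalEquiv.normalForm_boundaryValue hq hu hMn (hlim i)
  have hu0 : u ≠ 0 := norm_ne_zero_iff.1 (by rw [hu]; exact one_ne_zero)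
  set α : ℂ := I * (1 + u)
  set β : ℂ := -(1 - u)
  set γ : ℂ := 1 - u
  set δ : ℂ := I * (1 + u)
  have hpole : ∀ i, γ * (x' i : ℂ) + δ ≠ 0 := fun i h ↦ (hb i).1 <| by
    rw [cayleyFun_apply, mul_div_assoc', div_eq_one_iff_eq (add_I_ne_zero (by simp))]
    linear_combination -h
  have hx : (fun i ↦ (x i : ℂ)) =
      fun i ↦ ((q : ℂ) * ((α * x' i + β) / (γ * x' i + δ)) + p) / (0 * ((α * x' i + β) /
        (γ * x' i + δ)) + 1) := by
    funext i
    rw [zero_mul, zero_add, div_one, (hb i).2,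
      cayleyInvFun_mul_cayleyFun (add_I_ne_zero (by simp)) (hb i).1]
  have key : (crossRatio x : ℂ) = crossRatio x' := by
    rw [← cCrossRatio_ofReal, ← cCrossRatio_ofReal, hx,
      cCrossRatio_moebius _ (by simpa using (ofReal_ne_zero.2 hq.ne')) (by simp),
      cCrossRatio_moebius _ (by rw [det_cayley_conj]; exact mul_ne_zero (by norm_num) hu0) hpole]
  exact_mod_cast key

/-! ### SLE₆-preserving homeomorphisms preserve the conformal modulus -/

/-- The Dobrushin domain `(R; a, c)` of the image rectangle is the image of `(R; a, c)`. [folklore] -/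
theorem chord_map (R : ConformalRectangle) (T : ℂ ≃ₜ ℂ) :
    (R.map T).chord 0 2 (by decide) = (R.chord 0 2 (by decide)).map T := rfl

/-- **Crossing invariance (R1).** If the homeomorphism `T` pushes the chordal SLE₆ law of every
Dobrushin domain `D` to the chordal SLE₆ law of `T D`, then for every conformal rectangle `R`,
every conformal chart `φ : ℍ → R` with boundary values `R.pt i` at real points `x i`, and every
chart `φ' : ℍ → T R` with boundary values `T (R.pt i)` at `x' i`, the cross-ratios agree:
`crossRatio x = crossRatio x'`. Proof: Cardy's formula for SLE₆ (`sle_six_measureReal_hitsBefore_holds`)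
in `R` and in `R.map T`, transport of the crossing event (`preimage_curveClassMap_hitsBefore`,
`MarkedDomain.arc_map`), injectivity of Cardy's function on `[0, 1]`
(`strictMonoOn_cardyFunction_holds`), and `crossRatio_eq_of_hasBoundaryValue`. [cite: Werner2007, §3] -/
theorem crossRatio_eq_of_sle (T : ℂ ≃ₜ ℂ)
    (hT : ∀ (D : DobrushinDomain) (μ : Measure (CurveClass ℂ)), IsSLELaw 6 D μ →
      IsSLELaw 6 (D.map T) (μ.map (CurveClass.map (T : C(ℂ, ℂ)))))
    (R : ConformalRectangle) {φ : ConformalEquiv upperHalfPlaneSet R.carrier} {x : Fin 4 → ℝ}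
    {φ' : ConformalEquiv upperHalfPlaneSet (R.map T).carrier} {x' : Fin 4 → ℝ}
    (hφ : ∀ i, φ.HasBoundaryValue (x i) (R.pt i))
    (hφ' : ∀ i, φ'.HasBoundaryValue (x' i) ((R.map T).pt i)) :
    crossRatio x = crossRatio x' := by
  -- genuine uniformizing data of `R` and of `R.map T`
  obtain ⟨φ₀, x₀, hφ₀⟩ := MarkedDomain.exists_isUniformizing_holds R
  obtain ⟨φ₀', x₀', hφ₀'⟩ := MarkedDomain.exists_isUniformizing_holds (R.map T)
  -- the SLE₆ law of `(R; a, c)` and its image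
  obtain ⟨μ, hμ⟩ := exists_isSLELaw_of_ne_eight (κ := 6) (by norm_num) (by norm_num)
    (R.chord 0 2 (by decide))
  have hμ' : IsSLELaw 6 ((R.map T).chord 0 2 (by decide)) (μ.map (CurveClass.map (T : C(ℂ, ℂ)))) := by
    rw [chord_map]
    exact hT _ _ hμ
  -- Cardy's formula on both sides
  have h1 := sle_six_measureReal_hitsBefore_holds R hμ hφ₀
  have h2 := sle_six_measureReal_hitsBefore_holds (R.map T) hμ' hφ₀'
  rw [MarkedDomain.arc_map, MarkedDomain.arc_map,
    map_measureReal_apply (CurveClass.measurable_map _)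
      (CurveClass.measurableSet_hitsBefore_holds (T.isClosed_image.2 (R.isClosed_arc 2))
        (T.isClosed_image.2 (R.isClosed_arc 1))),
    preimage_curveClassMap_hitsBefore, h1] at h2
  -- injectivity of Cardy's function
  have h3 : crossRatio x₀ = crossRatio x₀' :=
    strictMonoOn_cardyFunction_holds.injOn
      (Ioo_subset_Icc_self (ConformalRectangle.crossRatio_mem_Ioo_of_isUniformizing hφ₀))
      (Ioo_subset_Icc_self (ConformalRectangle.crossRatio_mem_Ioo_of_isUniformizing hφ₀')) h2
  rw [crossRatio_eq_of_hasBoundaryValue hφ hφ₀.2, h3, crossRatio_eq_of_hasBoundaryValue hφ₀'.2 hφ']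

end Literature.Probability.RandomPlanarGeometry
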